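import Summits.QuantumAdvantage.QuantumAdvantage.Theorems.CubicForrelationNearExactIsExactCubicForm
import Summits.QuantumAdvantage.QuantumAdvantage.Theorems.CubicForrelationNearExactIsExactRothaus
import Mathlib.Data.Fin.Tuple.Basic

/-!
# Crux `CubicForrelation.NearExactIsExact` (stmt-QuantumAdvantage-14043) — vanishing third differences ⇒ degree `≤ 2`; the two HALVES
  of a function on `1 + n` bits (third differences and second-difference forms of the halves)

Certificate seat `b2b-cforr-cert` (gen 41).  HONEST FRAMING: kernel-checked bookkeeping (standard axioms), the glue between a cell `f` on
`1 + 8` bits with cubic form `s₀ ∧ ω` and the "two halves" format of …CubicFormHalves (`tcl_halves_rank`, cell lemma L2 of the light-cell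
analysis of `E1280-even`, HOME/b2b-cforr-cert-g39/E1280-HANDPROOFS.md App. A.4): the halves `f_b(s) = f(b, s)` have vanishing third
differences (the form `s₀ ∧ ω` vanishes on triples inside the hyperplane `s₀ = 0`), hence degree `≤ 2` (`tcz_deg_two_of_third_zero`, by the
tree's binary Möbius inversion `bb_moebius_isDegLeFun` and the cube bookkeeping of …CubicForm), and their second-difference forms differ by
the slice `ω = t̄(e₀, ·, ·)` (`tcz_halves_forms`, a 16-term identity).  Nothing about `θ₁₂`; NOT summit progress.

* `tcz_deg_two_of_third_zero`: all third differences of `g : 𝔽₂ⁿ → Bool` vanish ⇒ `IsDegLeFun 2 g`.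
* `tcz_append_bxor`, `tcz_half_third`: third differences of a half are third differences of `f` along embedded directions.
* `tcz_halves_forms`: `B₁(v,w) ⊕ B₀(v,w)` (second differences of the two halves at `x`) `=` the third difference of `f` along
  `e₀, ιv, ιw` at `(0, x)`.

References: F. J. MacWilliams, N. J. A. Sloane (1977) Ch. 13 §2–3 (Reed–Muller codes and Boolean derivatives).  Axioms: the standard three.
-/

set_option linter.dupNamespace false -- D-0017: single-problem summit ⇒ `QuantumAdvantage.QuantumAdvantage` by design

namespace Summit.QuantumAdvantage.QuantumAdvantage.Theorems.CubicForrelation.NearExactIsExact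

open Finset
open Literature.Computability.QuantumComplexity
open Literature.Computability.QuantumComplexity.BuzetChailloux (bxor zeroVec bxor_comm bxor_self bxor_zeroVec zeroVec_bxor
  bxor_bxor_cancel_left)

variable {n : ℕ}

/-- **Vanishing third differences give degree `≤ 2`.**  By Möbius inversion it suffices that `g` has an even number of ones on every
coordinate cube `E_I`, `#I ≥ 3`; for `#I = 3` this parity is the third difference along the three unit vectors (`tcf_third_cube`), and
`E_{I ∪ {i}}` splits into `E_I` and its translate by `eᵢ` (`tcf_cube_insert_card`), to which the statement for the translated function
applies. [cite: MacWilliamsSloane1977, Ch. 13 §3] -/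
theorem tcz_deg_two_of_third_zero (g : (Fin n → Bool) → Bool)
    (h3 : ∀ u v w x : Fin n → Bool, (((g x ^^ g (bxor x w)) ^^ (g (bxor x v) ^^ g (bxor (bxor x v) w))) ^^
        ((g (bxor x u) ^^ g (bxor (bxor x u) w)) ^^ (g (bxor (bxor x u) v) ^^ g (bxor (bxor (bxor x u) v) w)))) = false) :
    IsDegLeFun 2 g := by
  classical
  -- even cube counts for every function with vanishing third differences, by induction on `#I ≥ 3`
  have key : ∀ (k : ℕ) (κ : (Fin n → Bool) → Bool),
      (∀ u v w x : Fin n → Bool, (((κ x ^^ κ (bxor x w)) ^^ (κ (bxor x v) ^^ κ (bxor (bxor x v) w))) ^^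
        ((κ (bxor x u) ^^ κ (bxor (bxor x u) w)) ^^ (κ (bxor (bxor x u) v) ^^ κ (bxor (bxor (bxor x u) v) w)))) = false) →
      ∀ I : Finset (Fin n), #I = k + 3 →
        Even #((univ.filter fun y : Fin n → Bool => ∀ l, y l = true → l ∈ I).filter fun y => κ y = true) := by
    intro k
    induction k with
    | zero =>
      intro κ hκ I hI
      obtain ⟨i, j, l, hij, hil, hjl, rfl⟩ := card_eq_three.1 hI
      have e := tcf_third_cube κ i j l hij hil hjl
      rw [hκ] at e
      rw [← Nat.not_odd_iff_even]
      intro hodd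
      rw [decide_eq_true hodd] at e
      exact Bool.false_ne_true e
    | succ k ih =>
      intro κ hκ I hI
      obtain ⟨i, hi⟩ : I.Nonempty := by rw [← card_pos]; omega
      have hI' : #(I.erase i) = k + 3 := by rw [card_erase_of_mem hi]; omega
      have hins : I = insert i (I.erase i) := (insert_erase hi).symm
      rw [hins, tcf_cube_insert_card κ (I.erase i) i (notMem_erase i I)]
      refine Even.add (ih κ hκ _ hI') (ih (fun y => κ (bxor y (fun l => decide (l = i)))) (fun u v w x => ?_) _ hI')
      -- the translate has vanishing third differences too (base point `x ⊕ eᵢ`)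
      have e := hκ u v w (bxor x (fun l => decide (l = i)))
      have hce : ∀ s : Fin n → Bool, bxor (fun l => decide (l = i)) s = bxor s (fun l => decide (l = i)) :=
        fun s => bxor_comm _ s
      simp only [iw_bxor_assoc, hce] at e ⊢
      exact e
  refine bb_moebius_isDegLeFun 2 g fun I hI => ?_
  obtain ⟨k, hk⟩ : ∃ k, #I = k + 3 := ⟨#I - 3, by omega⟩
  have e := key k g h3 I hk
  rwa [filter_filter] at e

/-! ### The two halves of a function on `1 + n` bits -/

/-- `(v, s) ⊕ (v', s') = (v ⊕ v', s ⊕ s')`. [folklore] -/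
theorem tcz_append_bxor (v v' : Fin 1 → Bool) (s s' : Fin n → Bool) :
    bxor (Fin.append v s) (Fin.append v' s') = Fin.append (bxor v v') (bxor s s') := by
  funext l
  refine Fin.addCases (fun i => ?_) (fun σ => ?_) l
  · simp only [bxor, Fin.append_left]
  · simp only [bxor, Fin.append_right]

/-- **Third differences of a half.**  For `f` on `1 + n` bits, `b ∈ 𝔽₂` and the half `f_b(s) = f(b, s)`: the third difference of `f_b`
along `u, v, w` at `x` is the third difference of `f` along the embedded `(0,u), (0,v), (0,w)` at `(b, x)`. [folklore] -/
theorem tcz_half_third (f : (Fin (1 + n) → Bool) → Bool) (b : Fin 1 → Bool) (u v w x : Fin n → Bool) :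
    let fb : (Fin n → Bool) → Bool := fun s => f (Fin.append b s)
    let ι : (Fin n → Bool) → (Fin (1 + n) → Bool) := fun s => Fin.append (zeroVec : Fin 1 → Bool) s
    (((fb x ^^ fb (bxor x w)) ^^ (fb (bxor x v) ^^ fb (bxor (bxor x v) w))) ^^
        ((fb (bxor x u) ^^ fb (bxor (bxor x u) w)) ^^ (fb (bxor (bxor x u) v) ^^ fb (bxor (bxor (bxor x u) v) w)))) =
      (((f (Fin.append b x) ^^ f (bxor (Fin.append b x) (ι w))) ^^
          (f (bxor (Fin.append b x) (ι v)) ^^ f (bxor (bxor (Fin.append b x) (ι v)) (ι w)))) ^^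
        ((f (bxor (Fin.append b x) (ι u)) ^^ f (bxor (bxor (Fin.append b x) (ι u)) (ι w))) ^^
          (f (bxor (bxor (Fin.append b x) (ι u)) (ι v)) ^^ f (bxor (bxor (bxor (Fin.append b x) (ι u)) (ι v)) (ι w))))) := by
  intro fb ι
  simp only [fb, ι, tcz_append_bxor, bxor_zeroVec]

/-- **The forms of the two halves differ by the slice at `e₀`.**  With `f₀(s) = f(0,s)`, `f₁(s) = f(1,s)`:
`(f₁(x) ⊕ f₁(x⊕w) ⊕ f₁(x⊕v) ⊕ f₁(x⊕v⊕w)) ⊕ (f₀(x) ⊕ ⋯)` is the third difference of `f` along `e₀ = (1,0)`, `(0,v)`, `(0,w)` at `(0,x)`.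
[folklore] -/
theorem tcz_halves_forms (f : (Fin (1 + n) → Bool) → Bool) (v w x : Fin n → Bool) :
    let f₀ : (Fin n → Bool) → Bool := fun s => f (Fin.append ![false] s)
    let f₁ : (Fin n → Bool) → Bool := fun s => f (Fin.append ![true] s)
    let ι : (Fin n → Bool) → (Fin (1 + n) → Bool) := fun s => Fin.append (zeroVec : Fin 1 → Bool) s
    let e₀ : Fin (1 + n) → Bool := Fin.append ![true] (zeroVec : Fin n → Bool)
    (((f₀ x ^^ f₀ (bxor x w)) ^^ (f₀ (bxor x v) ^^ f₀ (bxor (bxor x v) w))) ^^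
        ((f₁ x ^^ f₁ (bxor x w)) ^^ (f₁ (bxor x v) ^^ f₁ (bxor (bxor x v) w)))) =
      (((f (ι x) ^^ f (bxor (ι x) (ι w))) ^^ (f (bxor (ι x) (ι v)) ^^ f (bxor (bxor (ι x) (ι v)) (ι w)))) ^^
        ((f (bxor (ι x) e₀) ^^ f (bxor (bxor (ι x) e₀) (ι w))) ^^
          (f (bxor (bxor (ι x) e₀) (ι v)) ^^ f (bxor (bxor (bxor (ι x) e₀) (ι v)) (ι w))))) := by
  intro f₀ f₁ ι e₀
  have h0 : (zeroVec : Fin 1 → Bool) = ![false] := by funext i; fin_cases i; rfl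
  have hb1 : bxor ![false] ![true] = ![true] := by funext i; fin_cases i; rfl
  have hb2 : bxor ![true] ![false] = ![true] := by funext i; fin_cases i; rfl
  have hb3 : bxor ![false] ![false] = ![false] := by funext i; fin_cases i; rfl
  simp only [f₀, f₁, ι, e₀, tcz_append_bxor, bxor_zeroVec, h0, hb1, hb2, hb3]

end Summit.QuantumAdvantage.QuantumAdvantage.Theorems.CubicForrelation.NearExactIsExact
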